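import Summits.RiemannHypothesis.RiemannHypothesis.Theorems.GroundBartaPolarPerronFrobeniusPolarLoss
import Literature.NumberTheory.LFunctions.WeilWindowSuzukiProofs
import Literature.NumberTheory.LFunctions.WeilWindowSuzukiAsymptoticProofs
import HarnessLib

/-!
# RiemannHypothesis / GroundBarta — crux `PolarPerronFrobenius` (stmt-RiemannHypothesis-18390):
# even-sector sign improvement, part E2a: increment gain and the truncated kernel

Helper file (`--supports stmt-RiemannHypothesis-18390`), RH-free, Mathlib + proved tree files only,
no definitions, no named facts.

For a real continuous compactly supported `f` write `p = f⁺ = max(f,0)`, `n = f⁻ = max(−f,0)`,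
`F = f`, `A = |f|` (as complex-valued functions), `D_t = weilIncrement`, `w = weilArchDensity`
and `k(t) = min(w(|t|), 5)` (the archimedean jump kernel truncated at height `5`).  This file turns
the `t`-integrated Beurling–Deny gain of `f ↦ |f|` into a bilinear form in `(x, y)`:

* `swe_weilIncrement_sub_abs`: `D_t(F) − D_t(A) = 4∫ n(x)(p(x+t) + p(x−t)) dx` (pointwise
  `(u−v)² − (|u|−|v|)² = 4(u⁺v⁻ + u⁻v⁺)` and a translation);
* `swe_integrable_truncKernel`: `k` is integrable on `ℝ`;
(the Fubini / translation / reflection identities are part E2b, `…EvenGainFubini.lean`).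

Part E3 combines these with the kernel inequality of part E1
(`k(x−y) + k(x+y) ≥ 4cosh(x/2)cosh(y/2)` on `[-a,a]²` off the diagonals, `a ≤ 1/4`) and the
polar identity `P(|f|) − P(f) = 8(∫f⁺cosh(·/2))(∫f⁻cosh(·/2))` for even `f`.

Prover B, speedrun unit `sr-gb-rung-b` (seat 2).
-/

set_option linter.dupNamespace false

noncomputable section

open Set MeasureTheory Filter Complex
open scoped Real Topology

namespace Summit.RiemannHypothesis.RiemannHypothesis.Theorems.PolarPerronFrobenius

open Literature.NumberTheory.LFunctions

/-! ## Positive and negative parts -/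

section Parts

variable {f : ℝ → ℝ}

/-- `f⁺` has compact support if `f` has. [folklore] -/
theorem swe_hasCompactSupport_posPart (hfs : HasCompactSupport f) :
    HasCompactSupport fun x ↦ max (f x) 0 := by
  refine hfs.mono fun x hx ↦ ?_
  rw [Function.mem_support] at hx ⊢
  intro h0
  apply hx
  rw [h0, max_self]

/-- `f⁻` has compact support if `f` has. [folklore] -/
theorem swe_hasCompactSupport_negPart (hfs : HasCompactSupport f) :
    HasCompactSupport fun x ↦ max (-f x) 0 :=
  swe_hasCompactSupport_posPart (f := fun x ↦ -f x) hfs.neg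

/-- A continuous compactly supported real function is bounded by a non-negative constant. [folklore] -/
theorem swe_exists_bound (hfc : Continuous f) (hfs : HasCompactSupport f) :
    ∃ C : ℝ, 0 ≤ C ∧ ∀ x, |f x| ≤ C := by
  obtain ⟨C, hC⟩ := hfc.norm.bddAbove_range_of_hasCompactSupport hfs.norm
  refine ⟨max C 0, le_max_right _ _, fun x ↦ ?_⟩
  have := hC (Set.mem_range_self x)
  rw [Real.norm_eq_abs] at this
  exact this.trans (le_max_left _ _)

/-- The pointwise identity behind the Beurling–Deny gain:
`(u − v)² − (|u| − |v|)² = 4 (u⁺ v⁻ + u⁻ v⁺)`. [folklore] -/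
theorem swe_sq_sub_sq_abs (u v : ℝ) :
    (u - v) ^ 2 - (|u| - |v|) ^ 2 = 4 * (max u 0 * max (-v) 0 + max (-u) 0 * max v 0) := by
  rcases le_total 0 u with hu | hu <;> rcases le_total 0 v with hv | hv
  · rw [abs_of_nonneg hu, abs_of_nonneg hv, max_eq_left hu, max_eq_left hv,
      max_eq_right (neg_nonpos.2 hu), max_eq_right (neg_nonpos.2 hv)]
    ring
  · rw [abs_of_nonneg hu, abs_of_nonpos hv, max_eq_left hu, max_eq_right hv,
      max_eq_right (neg_nonpos.2 hu), max_eq_left (neg_nonneg.2 hv)]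
    ring
  · rw [abs_of_nonpos hu, abs_of_nonneg hv, max_eq_right hu, max_eq_left hv,
      max_eq_left (neg_nonneg.2 hu), max_eq_right (neg_nonpos.2 hv)]
    ring
  · rw [abs_of_nonpos hu, abs_of_nonpos hv, max_eq_right hu, max_eq_right hv,
      max_eq_left (neg_nonneg.2 hu), max_eq_left (neg_nonneg.2 hv)]
    ring

end Parts

/-! ## The increment gain as an `x`-integral -/

section Increment

variable {f : ℝ → ℝ}

/-- **`D_t(f) − D_t(|f|) = 4∫ f⁻(x)(f⁺(x+t) + f⁺(x−t)) dx`** for a real continuous compactly supported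
`f` (both as complex-valued functions). [folklore] -/
theorem swe_weilIncrement_sub_abs (hfc : Continuous f) (hfs : HasCompactSupport f) (t : ℝ) :
    weilIncrement (fun x ↦ ((f x : ℝ) : ℂ)) t - weilIncrement (fun x ↦ ((|f x| : ℝ) : ℂ)) t =
      4 * ∫ x, max (-f x) 0 * (max (f (x + t)) 0 + max (f (x - t)) 0) := by
  have hp : Continuous fun x ↦ max (f x) 0 := hfc.max continuous_const
  have hn : Continuous fun x ↦ max (-f x) 0 := hfc.neg.max continuous_const
  have hns := swe_hasCompactSupport_negPart hfs
  have hps := swe_hasCompactSupport_posPart hfs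
  have hFm : MemLp (fun x ↦ ((f x : ℝ) : ℂ)) 2 volume :=
    (Complex.continuous_ofReal.comp hfc).memLp_of_hasCompactSupport
      (hfs.comp_left Complex.ofReal_zero)
  have hAm : MemLp (fun x ↦ ((|f x| : ℝ) : ℂ)) 2 volume :=
    (Complex.continuous_ofReal.comp hfc.abs).memLp_of_hasCompactSupport
      ((hfs.abs).comp_left Complex.ofReal_zero)
  have iF := integrable_weilIncrement_integrand hFm t
  have iA := integrable_weilIncrement_integrand hAm t
  -- pointwise
  have hpt : ∀ x, ‖((f (x + t) : ℝ) : ℂ) - ((f x : ℝ) : ℂ)‖ ^ 2 -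
      ‖((|f (x + t)| : ℝ) : ℂ) - ((|f x| : ℝ) : ℂ)‖ ^ 2 =
        4 * (max (-f x) 0 * max (f (x + t)) 0) + 4 * (max (-f (x + t)) 0 * max (f x) 0) := by
    intro x
    rw [← Complex.ofReal_sub, ← Complex.ofReal_sub, Complex.norm_real, Complex.norm_real,
      Real.norm_eq_abs, Real.norm_eq_abs, sq_abs, sq_abs, swe_sq_sub_sq_abs]
    ring
  have i1 : Integrable fun x ↦ 4 * (max (-f x) 0 * max (f (x + t)) 0) :=
    ((hn.mul (hp.comp (continuous_id.add continuous_const))).integrable_of_hasCompactSupport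
      hns.mul_right).const_mul 4
  have i3 : Integrable fun x ↦ 4 * (max (-f (x + t)) 0 * max (f x) 0) :=
    (((hn.comp (continuous_id.add continuous_const)).mul hp).integrable_of_hasCompactSupport
      hps.mul_left).const_mul 4
  have i2 : Integrable fun x ↦ max (-f x) 0 * max (f (x - t)) 0 :=
    (hn.mul (hp.comp (continuous_id.sub continuous_const))).integrable_of_hasCompactSupport
      hns.mul_right
  have i1' : Integrable fun x ↦ max (-f x) 0 * max (f (x + t)) 0 :=
    (hn.mul (hp.comp (continuous_id.add continuous_const))).integrable_of_hasCompactSupport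
      hns.mul_right
  -- translate the second piece
  have htr : ∫ x, 4 * (max (-f (x + t)) 0 * max (f x) 0) = ∫ x, 4 * (max (-f x) 0 * max (f (x - t)) 0) := by
    have h := integral_add_right_eq_self (μ := volume)
      (fun x ↦ 4 * (max (-f x) 0 * max (f (x - t)) 0)) t
    simp only [add_sub_cancel_right] at h
    exact h
  unfold weilIncrement
  rw [← integral_sub iF iA]
  simp_rw [hpt]
  rw [integral_add i1 i3, htr, integral_const_mul, integral_const_mul, ← mul_add,
    ← integral_add i1' i2]
  congr 1
  refine integral_congr_ae (Eventually.of_forall fun x ↦ ?_)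
  simp only
  ring

end Increment

/-! ## The truncated kernel `k(t) = min(w(|t|), 5)` -/

section Kernel

/-- `k(t) = min(w(|t|), 5)` is measurable. [folklore] -/
theorem swe_measurable_truncKernel : Measurable fun t : ℝ ↦ min (weilArchDensity |t|) 5 :=
  (measurable_weilArchDensity.comp measurable_abs).min measurable_const

/-- `0 ≤ k ≤ 5`. [folklore] -/
theorem swe_truncKernel_nonneg (t : ℝ) : 0 ≤ min (weilArchDensity |t|) 5 := by
  rcases eq_or_ne t 0 with h | h
  · subst h
    simp [weilArchDensity]
  · exact le_min (weilArchDensity_pos (abs_pos.2 h)).le (by norm_num)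

/-- `k ≤ 5`. [folklore] -/
theorem swe_truncKernel_le (t : ℝ) : min (weilArchDensity |t|) 5 ≤ 5 := min_le_right _ _

/-- `k` is even. [folklore] -/
theorem swe_truncKernel_neg (t : ℝ) : min (weilArchDensity |(-t)|) 5 = min (weilArchDensity |t|) 5 := by
  rw [abs_neg]

/-- `t ↦ min(w(t), 5)` is integrable on `(0, ∞)` (bounded near `0`, `≤ w` beyond `1`). [folklore] -/
theorem swe_integrableOn_truncKernel_Ioi :
    IntegrableOn (fun t : ℝ ↦ min (weilArchDensity t) 5) (Ioi 0) := by
  have hmeas : Measurable fun t : ℝ ↦ min (weilArchDensity t) 5 :=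
    measurable_weilArchDensity.min measurable_const
  have h1 : IntegrableOn (fun t : ℝ ↦ min (weilArchDensity t) 5) (Ioc 0 1) := by
    refine Integrable.mono'
      ((continuousOn_const (c := (5 : ℝ))).integrableOn_compact isCompact_Icc |>.mono_set
        Ioc_subset_Icc_self)
      hmeas.aestronglyMeasurable
      ((ae_restrict_iff' measurableSet_Ioc).2 (Eventually.of_forall fun t ht ↦ ?_))
    rw [Real.norm_of_nonneg (le_min (weilArchDensity_pos ht.1).le (by norm_num))]
    exact min_le_right _ _
  have h2 : IntegrableOn (fun t : ℝ ↦ min (weilArchDensity t) 5) (Ioi 1) := by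
    refine Integrable.mono' (integrableOn_weilArchDensity_Ioi one_pos) hmeas.aestronglyMeasurable
      ((ae_restrict_iff' measurableSet_Ioi).2 (Eventually.of_forall fun t (ht : 1 < t) ↦ ?_))
    have h0 : 0 < t := one_pos.trans ht
    rw [Real.norm_of_nonneg (le_min (weilArchDensity_pos h0).le (by norm_num))]
    exact min_le_left _ _
  rw [← Ioc_union_Ioi_eq_Ioi zero_le_one]
  exact h1.union h2

/-- **`k` is integrable on `ℝ`.** [folklore] -/
theorem swe_integrable_truncKernel : Integrable fun t : ℝ ↦ min (weilArchDensity |t|) 5 := by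
  have hIoi : IntegrableOn (fun t : ℝ ↦ min (weilArchDensity |t|) 5) (Ioi 0) := by
    refine (swe_integrableOn_truncKernel_Ioi.congr_fun (fun t ht ↦ ?_) measurableSet_Ioi)
    rw [abs_of_pos (mem_Ioi.1 ht)]
  have hIic : IntegrableOn (fun t : ℝ ↦ min (weilArchDensity |t|) 5) (Iic 0) := by
    rw [← Measure.map_neg_eq_self (volume : Measure ℝ)]
    let m : MeasurableEmbedding fun x : ℝ ↦ -x := (Homeomorph.neg ℝ).measurableEmbedding
    rw [m.integrableOn_map_iff]
    simp_rw [Function.comp_def, abs_neg, neg_preimage, neg_Iic, neg_zero]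
    exact Iff.mpr integrableOn_Ici_iff_integrableOn_Ioi hIoi
  have h := hIic.union hIoi
  rwa [Iic_union_Ioi, integrableOn_univ] at h

end Kernel

end Summit.RiemannHypothesis.RiemannHypothesis.Theorems.PolarPerronFrobenius

end
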